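import Literature.Geometry.Riemannian.CanonicalNeighbourhoods
import Literature.Geometry.Riemannian.CurvatureFamilyBounds
import Literature.Geometry.Riemannian.RicciFlow
import Literature.Geometry.Riemannian.RicciFlowMetricLimit
import Literature.Geometry.Riemannian.MetricFlowPointPicking
import Literature.Geometry.Riemannian.RicciFlowHConcentrationHolds
import HarnessLib

/-!
# The curvature scale `r_Rm` of a point in a Ricci flow (Bamler 2020a, Def. 10.1)

R. Bamler, *Entropy and heat kernel bounds on a Ricci flow background*, arXiv:2008.07093 (2020a),
§10.1, Def. 10.1 (arXiv v1 Def. 38): "For any point `(x,t) ∈ M × I` we define the curvature scale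
radius at `(x,t)` as `r_Rm(x,t) := sup { r > 0 : |Rm| ≤ r⁻² on P(x,t;r) }`. Note that `P(x,t;r)`
denotes the conventional parabolic neighborhood", where (§9.1, (9.1))
`P(x₀,t₀; A, −T⁻, T⁺) := B(x₀,t₀,A) × ([t₀ − T⁻, t₀ + T⁺] ∩ I)` and `P(x,t;r) := P(x,t; r, −r², r²)`.

We define `curvatureScale` for a family `(g_s, cov_s)` of metrics with connections on `M`, a time
set `S ⊆ ℝ` and a point `(x, t)`, as an extended nonnegative real (the supremum of the empty set is
`0`, of an unbounded set `∞` — e.g. on a flat flow), with `|Rm| ≤ r⁻²` in the frame sense of the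
tree (`CurvatureBoundedOn`, equivalent to a bound on `|Rm|_g` up to dimensional constants), and
prove the two properties the ε-regularity arguments of §10 use: a radius below the scale is
admissible (`curvatureBoundedOn_of_ofReal_lt_curvatureScale`), and on a Ricci flow of Riemannian
metrics on a closed manifold over a compact time interval the scale is bounded below by a positive
constant ("since `inf_{M×[0,1]} r_Rm > 0`", §10.2, proof of the Claim in the proof of Thm. 10.2;
`exists_pos_ofReal_le_curvatureScale`). Finally we introduce the truncated scale
`ρ = min(r_Rm, 1)` as a real function (`truncCurvatureScale`) and deduce the point-picking Claim of
§10.2 (arXiv v1 Claim 42) for it on the metric flow of a compact Ricci flow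
(`exists_point_picking_truncCurvatureScale`) from the abstract `MetricFlow.exists_point_picking`.

## References

* R. H. Bamler, *Entropy and heat kernel bounds on a Ricci flow background*, arXiv:2008.07093
  (2020), §9.1 (9.1); §10.1 Def. 10.1; §10.2, proof of Thm. 10.2, Claim. [Bamler2020Entropy]
-/

noncomputable section

open Set Filter Function
open scoped Manifold ContDiff Topology ENNReal NNReal

namespace Literature.Geometry.Riemannian

open Lorentzian Lorentzian.PseudoRiemannianMetric

universe u

variable {m : ℕ} {M : Type u} [TopologicalSpace M] [ChartedSpace (EuclideanSpace ℝ (Fin m)) M]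
  [IsManifold 𝓘(ℝ, EuclideanSpace ℝ (Fin m)) ∞ M]
  {h : ℝ → PseudoRiemannianMetric 𝓘(ℝ, EuclideanSpace ℝ (Fin m)) ∞ (EuclideanSpace ℝ (Fin m))
    (TangentSpace 𝓘(ℝ, EuclideanSpace ℝ (Fin m)) : M → Type _)}
  {cov : ℝ → CovariantDerivative 𝓘(ℝ, EuclideanSpace ℝ (Fin m)) (EuclideanSpace ℝ (Fin m))
    (TangentSpace 𝓘(ℝ, EuclideanSpace ℝ (Fin m)) : M → Type _)}
  {S : Set ℝ}

variable (h cov S) in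
/-- **Admissible radii for the curvature scale** (the property quantified in Bamler 2020a,
Def. 10.1): `r > 0` is admissible at `(x, t)` if `|Rm_{g_s}| ≤ r⁻²` (frame sense,
`CurvatureBoundedOn`) on the `g_t`-ball `B(x, t, r)` for every time `s ∈ [t − r², t + r²] ∩ S`, i.e.
on the conventional parabolic neighbourhood `P(x,t;r) = B(x,t,r) × ([t − r², t + r²] ∩ S)` of
§9.1 (9.1). [cite: Bamler2020Entropy, §10.1, Def. 10.1; §9.1, (9.1)] -/
def CurvatureScaleAdmissible (hR : ∀ s, (h s).IsRiemannian) (x : M) (t r : ℝ) : Prop :=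
  0 < r ∧ ∀ s ∈ Icc (t - r ^ 2) (t + r ^ 2) ∩ S,
    CurvatureBoundedOn (h s) (cov s) {y | (h t).edist (hR t) x y < ENNReal.ofReal r} (r ^ 2)⁻¹

variable (h cov S) in
/-- **The curvature scale** `r_Rm(x, t) := sup { r > 0 : |Rm| ≤ r⁻² on P(x,t;r) } ∈ [0, ∞]`
(Bamler 2020a, Def. 10.1; arXiv v1 Def. 38), as an extended nonnegative real: the supremum of the
admissible radii (`CurvatureScaleAdmissible`); `∞` when every radius is admissible (e.g. a flat
flow), `0` when none is. [cite: Bamler2020Entropy, §10.1, Def. 10.1] -/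
def curvatureScale (hR : ∀ s, (h s).IsRiemannian) (x : M) (t : ℝ) : ℝ≥0∞ :=
  sSup ((fun r : ℝ ↦ ENNReal.ofReal r) '' {r | CurvatureScaleAdmissible h cov S hR x t r})

variable {hR : ∀ s, (h s).IsRiemannian} {x : M} {t : ℝ}

/-- Admissibility is a down-set in the radius: a smaller positive radius has a smaller ball, a
shorter time window and a larger bound `r⁻²`. [cite: Bamler2020Entropy, §10.1, Def. 10.1] -/
theorem CurvatureScaleAdmissible.anti {r r' : ℝ} (hr : CurvatureScaleAdmissible h cov S hR x t r)
    (hr' : 0 < r') (hle : r' ≤ r) : CurvatureScaleAdmissible h cov S hR x t r' := by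
  refine ⟨hr', fun s hs ↦ ?_⟩
  have hs' : s ∈ Icc (t - r ^ 2) (t + r ^ 2) ∩ S := by
    have h2 : r' ^ 2 ≤ r ^ 2 := pow_le_pow_left₀ hr'.le hle 2
    exact ⟨⟨by linarith [hs.1.1], by linarith [hs.1.2]⟩, hs.2⟩
  refine (hr.2 s hs').mono (fun y hy ↦ ?_) ?_
  · exact lt_of_lt_of_le hy (ENNReal.ofReal_le_ofReal hle)
  · exact inv_anti₀ (pow_pos hr' 2) (pow_le_pow_left₀ hr'.le hle 2)

/-- An admissible radius bounds the curvature scale from below.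
[cite: Bamler2020Entropy, §10.1, Def. 10.1] -/
theorem ofReal_le_curvatureScale {r : ℝ} (hr : CurvatureScaleAdmissible h cov S hR x t r) :
    ENNReal.ofReal r ≤ curvatureScale h cov S hR x t :=
  le_sSup (mem_image_of_mem _ hr)

/-- **Radii below the curvature scale are admissible**: if `r < r_Rm(x,t)` (as extended reals) and
`r > 0`, then `|Rm| ≤ r⁻²` on `P(x,t;r)` (there is an admissible `r' > r`, and admissibility is a
down-set). [cite: Bamler2020Entropy, §10.1, Def. 10.1] -/
theorem curvatureScaleAdmissible_of_ofReal_lt_curvatureScale {r : ℝ} (hr : 0 < r)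
    (hlt : ENNReal.ofReal r < curvatureScale h cov S hR x t) :
    CurvatureScaleAdmissible h cov S hR x t r := by
  obtain ⟨ρ, hρ, hrρ⟩ := exists_lt_of_lt_csSup' (s := (fun r : ℝ ↦ ENNReal.ofReal r) ''
    {r | CurvatureScaleAdmissible h cov S hR x t r}) hlt
  obtain ⟨r', hr', rfl⟩ := hρ
  have hrr' : r < r' := by
    have := (ENNReal.ofReal_lt_ofReal_iff_of_nonneg hr.le).1 hrρ
    exact this
  exact hr'.anti hr hrr'.le

/-- **Radii below the curvature scale are admissible**, unfolded: `|Rm_{g_s}| ≤ r⁻²` on the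
`g_t`-ball `B(x,t,r)` for all `s ∈ [t − r², t + r²] ∩ S`.
[cite: Bamler2020Entropy, §10.1, Def. 10.1] -/
theorem curvatureBoundedOn_of_ofReal_lt_curvatureScale {r : ℝ} (hr : 0 < r)
    (hlt : ENNReal.ofReal r < curvatureScale h cov S hR x t) {s : ℝ}
    (hs : s ∈ Icc (t - r ^ 2) (t + r ^ 2) ∩ S) :
    CurvatureBoundedOn (h s) (cov s) {y | (h t).edist (hR t) x y < ENNReal.ofReal r} (r ^ 2)⁻¹ :=
  (curvatureScaleAdmissible_of_ofReal_lt_curvatureScale hr hlt).2 s hs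

/-- **The scale is at most `r` when `r` is not admissible** (contrapositive of the previous fact,
the form "`r_Rm(x,t) ≤ r`" is used in: if `|Rm| ≤ r⁻²` fails somewhere on `P(x,t;r)`).
[cite: Bamler2020Entropy, §10.1, Def. 10.1] -/
theorem curvatureScale_le_ofReal {r : ℝ} (hr : 0 < r)
    (hnot : ¬ CurvatureScaleAdmissible h cov S hR x t r) :
    curvatureScale h cov S hR x t ≤ ENNReal.ofReal r :=
  not_lt.1 fun hlt ↦ hnot (curvatureScaleAdmissible_of_ofReal_lt_curvatureScale hr hlt)

/-- **A uniform curvature bound gives a uniform positive lower bound for the scale**: if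
`|Rm_{g_s}| ≤ K` on all of `M` for every `s ∈ S` and `0 < r`, `r² K ≤ 1`, then `r` is admissible at
every `(x, t)`. [cite: Bamler2020Entropy, §10.1, Def. 10.1] -/
theorem curvatureScaleAdmissible_of_curvatureBoundedBy {K r : ℝ}
    (hK : ∀ s ∈ S, CurvatureBoundedBy (h s) (cov s) K) (hr : 0 < r) (hrK : r ^ 2 * K ≤ 1)
    (x : M) (t : ℝ) : CurvatureScaleAdmissible h cov S hR x t r := by
  refine ⟨hr, fun s hs ↦ ?_⟩
  have hKle : K ≤ (r ^ 2)⁻¹ := by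
    rw [← one_div, le_div_iff₀ (pow_pos hr 2)]
    calc K * r ^ 2 = r ^ 2 * K := mul_comm _ _
      _ ≤ 1 := hrK
  exact (curvatureBoundedOn_univ_iff.2 (hK s hs.2)).mono (subset_univ _) hKle

/-- **On a compact flow the curvature scale is uniformly positive** (Bamler 2020a, §10.2, proof
of the Claim in the proof of Thm. 10.2: "since `inf_{M×[0,1]} r_Rm > 0`"): for a Ricci flow of
Riemannian metrics on a closed manifold over `[a, T]` there is `ρ₀ > 0` with `ρ₀ ≤ r_Rm(x, t)` for
all `x` and `t` (`|Rm| ≤ K` on `M × [a, T]` by compactness,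
`IsContMDiffFamilyOn.exists_curvatureBoundedBy_of_isCompact`, and `ρ₀ := (max K 1)^{-1/2}`).
[cite: Bamler2020Entropy, §10.2, proof of Thm. 10.2, Claim] -/
theorem exists_pos_ofReal_le_curvatureScale [T2Space M] [CompactSpace M] {a T : ℝ}
    (hflow : IsRicciFlow h cov (Icc a T)) (hR : ∀ s, (h s).IsRiemannian) :
    ∃ ρ₀ : ℝ, 0 < ρ₀ ∧ ∀ (x : M) (t : ℝ),
      CurvatureScaleAdmissible h cov (Icc a T) hR x t ρ₀ ∧
      ENNReal.ofReal ρ₀ ≤ curvatureScale h cov (Icc a T) hR x t := by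
  obtain ⟨K, hK⟩ := hflow.smooth.exists_curvatureBoundedBy_of_isCompact hflow.isLeviCivita
    isCompact_Icc (subset_refl _) (fun s _ ↦ hR s)
  have hK1 : (1 : ℝ) ≤ max K 1 := le_max_right _ _
  have hK0 : 0 < max K 1 := one_pos.trans_le hK1
  refine ⟨(Real.sqrt (max K 1))⁻¹, by positivity, fun x t ↦ ?_⟩
  have hadm : CurvatureScaleAdmissible h cov (Icc a T) hR x t (Real.sqrt (max K 1))⁻¹ := by
    refine curvatureScaleAdmissible_of_curvatureBoundedBy
      (fun s hs ↦ (hK s hs).mono (le_max_left K 1)) (by positivity) ?_ x t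
    rw [inv_pow, Real.sq_sqrt hK0.le, inv_mul_cancel₀ hK0.ne']
  exact ⟨hadm, ofReal_le_curvatureScale hadm⟩


/-! ### The Ricci bound below the scale (the form consumed by the `P*`-comparison results) -/

/-- **A local curvature bound bounds the Ricci tensor at the points of the set**: if `|Rm| ≤ K`
on `U` in the frame sense and `g` is Riemannian, then `|Ric(X, X)| ≤ m K g(X, X)` at every
`x ∈ U` (O'Neill 1983, Lemma 3.52: `Ric(X,X) = Σ Rm(b_i, X, X, b_i)` in an orthonormal basis; the
global version is `CurvatureBoundedBy.abs_ricci_le`). [cite: ONeill1983, Ch. 3, Lemma 3.52] -/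
theorem CurvatureBoundedOn.abs_ricci_le
    {g : PseudoRiemannianMetric 𝓘(ℝ, EuclideanSpace ℝ (Fin m)) ∞ (EuclideanSpace ℝ (Fin m))
      (TangentSpace 𝓘(ℝ, EuclideanSpace ℝ (Fin m)) : M → Type _)}
    {cv : CovariantDerivative 𝓘(ℝ, EuclideanSpace ℝ (Fin m)) (EuclideanSpace ℝ (Fin m))
      (TangentSpace 𝓘(ℝ, EuclideanSpace ℝ (Fin m)) : M → Type _)}
    {U : Set M} {K : ℝ} (hK : CurvatureBoundedOn g cv U K) (hg : g.IsRiemannian) {x : M}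
    (hx : x ∈ U) (X : TangentSpace 𝓘(ℝ, EuclideanSpace ℝ (Fin m)) x) :
    |cv.ricci x X X| ≤ m * K * g.val x X X := by
  -- the frame bound at the single point `x` is a `CurvatureBoundedBy` bound for the data at `x`;
  -- we rerun the orthonormal-frame argument of the global version at `x`
  by_cases hX : X = 0
  · subst hX; simp
  have hunit : ∀ Y : TangentSpace 𝓘(ℝ, EuclideanSpace ℝ (Fin m)) x, g.val x Y Y ≤ 1 →
      |cv.ricci x Y Y| ≤ m * K := by
    intro Y hY
    obtain ⟨b, hb⟩ := g.exists_basis_isOrthonormalFrame (x := x) (hg x) rfl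
    rw [g.ricci_eq_sum_of_isOrthonormalFrame b hb cv Y Y]
    refine (Finset.abs_sum_le_sum_abs _ _).trans ?_
    calc ∑ i, |g.curvatureForm cv x (b i) Y Y (b i)|
        ≤ ∑ _i : Fin (Module.finrank ℝ (EuclideanSpace ℝ (Fin m))), K :=
          Finset.sum_le_sum fun i _ ↦ hK x hx (b i) Y Y (b i) (hb.1 i).le hY hY (hb.1 i).le
      _ = m * K := by simp
  set c : ℝ := g.val x X X with hc
  have hcpos : 0 < c := hg x X hX
  set a : ℝ := Real.sqrt c with ha
  have hapos : 0 < a := Real.sqrt_pos.2 hcpos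
  have haa : a * a = c := Real.mul_self_sqrt hcpos.le
  set Y : TangentSpace 𝓘(ℝ, EuclideanSpace ℝ (Fin m)) x := a⁻¹ • X with hY
  have hXY : X = a • Y := by
    rw [hY, smul_smul, mul_inv_cancel₀ hapos.ne', one_smul]
  have hYY : g.val x Y Y = 1 := by
    have ha0 : a ≠ 0 := hapos.ne'
    simp only [hY, map_smul, FunLike.coe_smul, Pi.smul_apply, smul_eq_mul]
    rw [← hc, ← haa]
    field_simp
  have hRic : cv.ricci x X X = c * cv.ricci x Y Y := by
    rw [hXY]
    simp only [map_smul, LinearMap.smul_apply, smul_eq_mul]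
    rw [← haa]
    ring
  rw [hRic, abs_mul, abs_of_pos hcpos]
  calc c * |cv.ricci x Y Y| ≤ c * (m * K) := by gcongr; exact hunit Y hYY.le
    _ = m * K * c := by ring

/-- **Below the curvature scale the Ricci tensor is bounded on the conventional neighbourhood**:
if `r` is admissible at `(x, t)` (e.g. `r < r_Rm(x,t)`) and the metrics are Riemannian, then
`|Ric_{g_s}(y)(v, v)| ≤ m r⁻² g_s(y)(v, v)` for all `s ∈ [t − r², t + r²] ∩ S` and all `y` with
`d_{g_t}(x, y) < r` — the hypothesis shape of the `P*`-comparison results (Cor. 9.6).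
[cite: Bamler2020Entropy, §10.1, Def. 10.1; §9.1, Cor. 9.6] -/
theorem CurvatureScaleAdmissible.abs_ricci_le {r : ℝ}
    (hr : CurvatureScaleAdmissible h cov S hR x t r) {s : ℝ}
    (hs : s ∈ Icc (t - r ^ 2) (t + r ^ 2) ∩ S) {y : M}
    (hy : (h t).edist (hR t) x y < ENNReal.ofReal r)
    (v : TangentSpace 𝓘(ℝ, EuclideanSpace ℝ (Fin m)) y) :
    |(cov s).ricci y v v| ≤ m * (r ^ 2)⁻¹ * (h s).val y v v :=
  CurvatureBoundedOn.abs_ricci_le (hr.2 s hs) (hR s) hy v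

/-! ### The truncated scale and point picking (Bamler 2020a, §10.2, Claim in the proof of Thm. 10.2) -/

variable (h cov S) in
/-- **Truncated curvature scale** `ρ(x,t) := min(r_Rm(x,t), 1)` as a real number in `(0, 1]`
(the truncation level `1` is the normalisation `r = 1` of Bamler 2020a, §10.2, where the Claim is
applied with `10 A r_Rm ≤ 1/2`). [cite: Bamler2020Entropy, §10.2, proof of Thm. 10.2, Claim] -/
def truncCurvatureScale (hR : ∀ s, (h s).IsRiemannian) (x : M) (t : ℝ) : ℝ :=
  (min (curvatureScale h cov S hR x t) 1).toReal

/-- `ρ(x,t) ≤ 1`. [cite: Bamler2020Entropy, §10.2, proof of Thm. 10.2, Claim] -/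
theorem truncCurvatureScale_le_one : truncCurvatureScale h cov S hR x t ≤ 1 := by
  unfold truncCurvatureScale
  have h1 : min (curvatureScale h cov S hR x t) 1 ≤ 1 := min_le_right _ _
  simpa using ENNReal.toReal_mono ENNReal.one_ne_top h1

/-- An admissible radius `r ≤ 1` bounds the truncated scale from below.
[cite: Bamler2020Entropy, §10.2, proof of Thm. 10.2, Claim] -/
theorem le_truncCurvatureScale {r : ℝ} (hr : CurvatureScaleAdmissible h cov S hR x t r)
    (hr1 : r ≤ 1) : r ≤ truncCurvatureScale h cov S hR x t := by
  unfold truncCurvatureScale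
  have hle : ENNReal.ofReal r ≤ min (curvatureScale h cov S hR x t) 1 :=
    le_min (ofReal_le_curvatureScale hr) (by simpa using ENNReal.ofReal_le_ofReal hr1)
  have hfin : min (curvatureScale h cov S hR x t) 1 ≠ (⊤ : ℝ≥0∞) :=
    ne_top_of_le_ne_top ENNReal.one_ne_top (min_le_right _ _)
  have := ENNReal.toReal_mono hfin hle
  rwa [ENNReal.toReal_ofReal hr.1.le] at this

/-- **Radii below the truncated scale are admissible**: `0 < r < ρ(x,t)` implies `|Rm| ≤ r⁻²` on
`P(x,t;r)`. [cite: Bamler2020Entropy, §10.1, Def. 10.1; §10.2] -/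
theorem curvatureScaleAdmissible_of_lt_truncCurvatureScale {r : ℝ} (hr : 0 < r)
    (hlt : r < truncCurvatureScale h cov S hR x t) :
    CurvatureScaleAdmissible h cov S hR x t r := by
  refine curvatureScaleAdmissible_of_ofReal_lt_curvatureScale hr ?_
  unfold truncCurvatureScale at hlt
  have hfin : min (curvatureScale h cov S hR x t) 1 ≠ (⊤ : ℝ≥0∞) :=
    ne_top_of_le_ne_top ENNReal.one_ne_top (min_le_right _ _)
  have h1 : ENNReal.ofReal r < min (curvatureScale h cov S hR x t) 1 := by
    rw [← ENNReal.ofReal_toReal hfin]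
    exact (ENNReal.ofReal_lt_ofReal_iff_of_nonneg hr.le).2 hlt
  exact lt_of_lt_of_le h1 (min_le_left _ _)

/-- **Point picking for the curvature scale** (Bamler 2020a, §10.2, Claim in the proof of
Thm. 10.2 / arXiv v1 Claim 42, for the truncated scale `ρ = min(r_Rm, 1)` and an arbitrary
`A > 0`): on a Ricci flow of Riemannian metrics on a closed connected `m`-manifold (`m ≥ 1`) over
`[a, T]`, with metric flow `𝒳`, for every point `(x, t)` with `a ≤ t − 200 A²` there is a point
`(x', t') ∈ P*⁻((x,t); 10 A ρ(x,t))` with `ρ(x',t') ≤ ρ(x,t)` and `ρ ≥ ρ(x',t')/10` on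
`P*⁻((x',t'); A ρ(x',t'))` — the abstract `MetricFlow.exists_point_picking` applied to `ρ`, which
is bounded below by a positive constant on the compact flow (`exists_pos_ofReal_le_curvatureScale`).
[cite: Bamler2020Entropy, §10.2, proof of Thm. 10.2, Claim] -/
theorem exists_point_picking_truncCurvatureScale [T2Space M] [CompactSpace M]
    [SecondCountableTopology M] [MeasurableSpace M] [BorelSpace M] [ConnectedSpace M]
    (hm : 0 < m) {a T : ℝ} (hflow : IsRicciFlow h cov (Icc a T))
    (hh : IsContMDiffFamilyOn ∞ h univ) (hR : ∀ s, (h s).IsRiemannian) {A : ℝ} (hA : 0 < A)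
    {t : ℝ} (ht : t ∈ Icc a T) (x : M) (hat : a ≤ t - 200 * A ^ 2) :
    ∃ (t' : ℝ) (ht' : t' ∈ Icc a T) (x' : M)
      (hx : t - (10 * A * truncCurvatureScale h cov (Icc a T) hR x t) ^ 2 ∈ Icc a T)
      (hx' : t' - (A * truncCurvatureScale h cov (Icc a T) hR x' t') ^ 2 ∈ Icc a T),
      (⟨⟨t', ht'⟩, x'⟩ : (ricciFlowMetricFlow hh hR Set.ordConnected_Icc hflow).Pt) ∈
        (ricciFlowMetricFlow hh hR Set.ordConnected_Icc hflow).pParabolicBallBwd ⟨⟨t, ht⟩, x⟩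
          (10 * A * truncCurvatureScale h cov (Icc a T) hR x t) hx ∧
      truncCurvatureScale h cov (Icc a T) hR x' t' ≤ truncCurvatureScale h cov (Icc a T) hR x t ∧
      ∀ (s : ℝ) (hs : s ∈ Icc a T) (y : M),
        (⟨⟨s, hs⟩, y⟩ : (ricciFlowMetricFlow hh hR Set.ordConnected_Icc hflow).Pt) ∈
          (ricciFlowMetricFlow hh hR Set.ordConnected_Icc hflow).pParabolicBallBwd ⟨⟨t', ht'⟩, x'⟩
            (A * truncCurvatureScale h cov (Icc a T) hR x' t') hx' →
        truncCurvatureScale h cov (Icc a T) hR x' t' / 10 ≤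
          truncCurvatureScale h cov (Icc a T) hR y s := by
  set 𝒳 : MetricFlow (Icc a T) := ricciFlowMetricFlow hh hR Set.ordConnected_Icc hflow with h𝒳
  have hH := ricciFlowMetricFlow_isHConcentrated hm hh hR Set.ordConnected_Icc hflow
  -- the function `ρ` on the points of `𝒳` and its positive lower bound
  let ρ : 𝒳.Pt → ℝ := fun p ↦ truncCurvatureScale h cov (Icc a T) hR p.2 p.1
  obtain ⟨ρ₀, hρ₀, hρ₀le⟩ := exists_pos_ofReal_le_curvatureScale hflow hR
  have hρ : ∀ p : 𝒳.Pt, min ρ₀ 1 ≤ ρ p := fun p ↦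
    le_truncCurvatureScale ((hρ₀le p.2 p.1).1.anti (lt_min hρ₀ one_pos) (min_le_left _ _))
      (min_le_right _ _)
  have hρ1 : ρ ⟨⟨t, ht⟩, x⟩ ≤ 1 := truncCurvatureScale_le_one
  have hρx0 : 0 < ρ ⟨⟨t, ht⟩, x⟩ := (lt_min hρ₀ one_pos).trans_le (hρ _)
  -- the interval hypothesis of the abstract statement
  have hI : Icc ((t : ℝ) - 200 * A ^ 2 * ρ ⟨⟨t, ht⟩, x⟩ ^ 2) t ⊆ Icc a T := by
    refine Icc_subset_Icc ?_ ht.2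
    have : ρ ⟨⟨t, ht⟩, x⟩ ^ 2 ≤ 1 := by nlinarith
    nlinarith [sq_nonneg A]
  obtain ⟨p, hx₁, hp, hmem, hle, hmax⟩ :=
    MetricFlow.exists_point_picking hH ρ (lt_min hρ₀ one_pos) hρ hA ⟨⟨t, ht⟩, x⟩ hI
  obtain ⟨⟨t', ht'⟩, x'⟩ := p
  exact ⟨t', ht', x', hx₁, hp, hmem, hle, fun s hs y hq ↦ hmax ⟨⟨s, hs⟩, y⟩ hq⟩

end Literature.Geometry.Riemannian

end
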